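import Mathlib
import Summits.Ventures.PercRepro2.OneTypedEdge

/-!
# The kill: two typed root edges of type `≥ 2` at one vertex (blind cell PercRepro2, mine-2 g44,
2026-08-29)

A vertex `u ≠ a₁, a₂` carrying the typed edges `e₁ = u–a₁` and `e₂ = u–a₂` with `τ e₁ ≥ 2` and
`τ e₂ ≥ 2` kills every typed triple: among three copies, two carry `e₁` and two carry `e₂`, so some
copy carries both and has `a₁ ↔ a₂` through `u`, where the kernel `K₃` vanishes
(`KB_eq_zero_of_q'`).  On the seven-vertex census (mine-2 g43, M2-88) this is the ONLY source of
identically-vanishing statements; here it is the kernel theorem `typedCount_eq_zero_of_root_two_two`,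
for every graph, every `z`, every `F ∋ e₁, e₂` and every type vector with `τ e₁, τ e₂ ≥ 2` (types
`2` and `3`, the marks `o`, `a₃`, `b` or an unmarked `u` alike).  Own code; standard axioms.
-/

namespace Summit.Ventures.PercRepro2

open UnionCluster

namespace CovForm

namespace TypedRed

open OneTyped

section Kill

open Classical

variable {V : Type*} {E : Type*} [Fintype E] [DecidableEq E] {R : Type*} [Field R]

omit [Fintype E] [DecidableEq E] in
/-- Pigeonhole over three copies: two edges each open in at least two copies are both open in
some copy. -/
lemma exists_both_open_of_openCount (x y w : Config E) (e₁ e₂ : E)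
    (h1 : 2 ≤ openCount x y w e₁) (h2 : 2 ≤ openCount x y w e₂) :
    (x e₁ = true ∧ x e₂ = true) ∨ (y e₁ = true ∧ y e₂ = true) ∨ (w e₁ = true ∧ w e₂ = true) := by
  unfold openCount at h1 h2
  cases hx1 : x e₁ <;> cases hy1 : y e₁ <;> cases hw1 : w e₁ <;> cases hx2 : x e₂ <;>
    cases hy2 : y e₂ <;> cases hw2 : w e₂ <;> simp_all

omit [Fintype E] [DecidableEq E] in
/-- A copy carrying `u–a₁` and `u–a₂` has `a₂ ↔ a₁`: its state fails `Q`. -/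
lemma st_q'_of_both_root_edges (ends : E → Sym2 V) (o a₁ a₂ a₃ b : V) {u : V} {e₁ e₂ : E}
    (h1 : ends e₁ = s(u, a₁)) (h2 : ends e₂ = s(u, a₂)) (x : Config E) (hx1 : x e₁ = true)
    (hx2 : x e₂ = true) : (st ends o a₁ a₂ a₃ b x).q' = true := by
  show decide (Conn ends x a₂ a₁) = true
  have hu2 : Conn ends x a₂ u := conn_of_openAdj ⟨e₂, hx2, by rw [h2, Sym2.eq_swap]⟩
  have hu1 : Conn ends x u a₁ := conn_of_openAdj ⟨e₁, hx1, h1⟩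
  exact decide_eq_true (conn_trans hu2 hu1)

/-- **The kill**: two typed root edges of type `≥ 2` at one vertex make every typed count of `K₃`
vanish. -/
theorem typedCount_eq_zero_of_root_two_two (ends : E → Sym2 V) (o a₁ a₂ a₃ b : V) {u : V}
    {e₁ e₂ : E} (h1 : ends e₁ = s(u, a₁)) (h2 : ends e₂ = s(u, a₂)) (F : Finset E) (h1F : e₁ ∈ F)
    (h2F : e₂ ∈ F) (z : Config E) (τ : E → ℕ) (hτ1 : 2 ≤ τ e₁) (hτ2 : 2 ≤ τ e₂) :
    typedCount F z τ (K3 ends o a₁ a₂ a₃ b : Config E → Config E → Config E → R) = 0 := by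
  unfold typedCount
  refine Finset.sum_eq_zero fun x _ => Finset.sum_eq_zero fun y _ => Finset.sum_eq_zero fun w _ => ?_
  split_ifs with h
  · have hc1 := h.2 e₁ h1F
    have hc2 := h.2 e₂ h2F
    rcases exists_both_open_of_openCount x y w e₁ e₂ (by omega) (by omega) with
      ⟨hx1, hx2⟩ | ⟨hy1, hy2⟩ | ⟨hw1, hw2⟩
    · rw [K3_eq_KB, KB_eq_zero_of_q' _ _ _
        (Or.inl (st_q'_of_both_root_edges ends o a₁ a₂ a₃ b h1 h2 x hx1 hx2))]
      simp
    · rw [K3_eq_KB, KB_eq_zero_of_q' _ _ _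
        (Or.inr (Or.inl (st_q'_of_both_root_edges ends o a₁ a₂ a₃ b h1 h2 y hy1 hy2)))]
      simp
    · rw [K3_eq_KB, KB_eq_zero_of_q' _ _ _
        (Or.inr (Or.inr (st_q'_of_both_root_edges ends o a₁ a₂ a₃ b h1 h2 w hw1 hw2)))]
      simp
  · rfl

end Kill

end TypedRed

end CovForm

end Summit.Ventures.PercRepro2
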